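import Summits.BirchSwinnertonDyer.BirchSwinnertonDyer.Theorems.KolyvaginRoadThreeSchneiderTamAtThreeHeightLogNumeratorExactPFormalLog
import Summits.BirchSwinnertonDyer.BirchSwinnertonDyer.Theorems.KolyvaginRoadThreeSchneiderTamAtThreeHeightLogNumeratorExactPSeries
import Summits.BirchSwinnertonDyer.BirchSwinnertonDyer.Theorems.KolyvaginRoadThreeSchneiderTamAtThreeHeightLogNumeratorExactPWeierstrassPoly
import HarnessLib

/-!
# «The height is the logarithm of the numerator» — the EXACT second-order law at EVERY multiplicative
# prime `p ≥ 5`, part 2b: `x·ℓ² = 1 − (b₂/12)ℓ² + (c₄/240)ℓ⁴ + O(‖x‖⁻²)` and `log_p(x·ℓ²)` at LEVEL ONE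

HONEST FRAMING (cell `bsd-stepL`, seat `bsd-stepL-tam3-p2` g5, WIDTH-LEVER second lane «closed-form Schneider
local factor … by Kodaira type (finite case table proved once)»; `--supports stmt-BirchSwinnertonDyer-19154 --as helper`):
THEOREMS ONLY, unconditional, route-independent (no Theses import); 0 definitions, 0 named facts, 0 sorry;
nothing here proves the crux `SchneiderTamAtThree`, Schneider's conjecture or BSD. `p ≥ 5` twins of the `p = 3`
parts 2b (`…DeepWeierstrassP`) and 3a (`…DeepLog`, first theorem) of the chain (g2), valid from level ONE
(`‖z‖_p ≤ p⁻¹`) for a `p`-integral equation over `ℚ_p`: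

* `norm_padicFormalLog_sub_self_le_sq_padic` — `‖log_W z − z‖ ≤ ‖z‖²` (`p ≥ 5`, `‖z‖ ≤ p⁻¹`);
* `norm_x_mul_formalLog_sq_sub_le_padic` — **`‖x·ℓ² − 1 + (b₂/12)ℓ² − (c₄/240)ℓ⁴‖_p ≤ ‖x‖_p⁻²`** (`ℓ = log_W(−x/y)`):
  `ℓ = z·S + τ` (`S` = quintic truncation of `log_W/z`, `‖τ‖ ≤ ‖z‖⁶`, part 1a), `x z² = Q + ρ` (`‖ρ‖ ≤ ‖z‖⁴`, part 1b),
  the polynomial identity of part 2a, and `‖(c₄/240)(ℓ⁴ − z⁴)‖ ≤ p‖z‖⁵ ≤ ‖z‖⁴`;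
* `norm_padicLog_x_mul_formalLog_sq_sub_le_padic` — **`‖log_p(x·ℓ²) − (−(b₂/12)ℓ² + (c₄/240 − b₂²/288)ℓ⁴)‖_p ≤ ‖x‖_p⁻²`**
  (`u = xℓ² − 1`, `‖u‖ ≤ ‖z‖²`, `log_p(1+u) = u − u²/2 + O(‖u‖³)`).

References: [SilvermanAEC2009] IV.1, IV.6.4, VI.3, VII.2.2; [Iwasawa1972PadicL] §4.4; tree: g2 `…DeepWeierstrassP`,
`…DeepLog` (`p = 3`).
-/

noncomputable section

open scoped Classical
open IsUltrametricDist PowerSeries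
open WeierstrassCurve Literature.NumberTheory.EllipticCurves

namespace Summit.BirchSwinnertonDyer.Rank1Residual.X11b.RegMult.HeightLogNumerator

variable {p : ℕ} [hp : Fact p.Prime]

section WeierstrassP

variable (V : WeierstrassCurve ℚ_[p]) [V.IsIntegral ℤ_[p]]

/-- **`‖log_W(z) − z‖_p ≤ ‖z‖_p²` for `‖z‖_p ≤ p⁻¹`, `p ≥ 5`** (from the cubic truncation of part A of the `p ≥ 5`
first-order chain: every term `½a₁z², ⅓(a₁²+a₂)z³, O(z⁴)` has norm `≤ ‖z‖²`). [cite: SilvermanAEC2009, IV.5.5, IV.6.4] -/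
theorem norm_padicFormalLog_sub_self_le_sq_padic (hp5 : 5 ≤ p) {z : ℚ_[p]} (hz : ‖z‖ ≤ (p : ℝ)⁻¹) :
    ‖V.padicFormalLog z - z‖ ≤ ‖z‖ ^ 2 := by
  have hp2 : p ≠ 2 := by omega
  have hp3 : p ≠ 3 := by omega
  have hp1 : (1 : ℝ) ≤ p := by exact_mod_cast hp.out.one_lt.le
  have hz1 : ‖z‖ ≤ 1 := hz.trans (inv_le_one_of_one_le₀ hp1)
  have hz0 : 0 ≤ ‖z‖ := norm_nonneg z
  obtain ⟨ha1, ha2, -, -, -⟩ := V.norm_coeffs_le_one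
  have h2i : ‖(2 : ℚ_[p])⁻¹‖ = 1 := by
    rw [norm_inv]; simpa using Padic.norm_natCast_eq_one_iff.mpr ((Nat.coprime_primes hp.out Nat.prime_two).mpr hp2)
  have h3i : ‖(3 : ℚ_[p])⁻¹‖ = 1 := by
    rw [norm_inv]
    simpa using Padic.norm_natCast_eq_one_iff.mpr ((Nat.coprime_primes hp.out Nat.prime_three).mpr hp3)
  have hτ := norm_padicFormalLog_sub_cubic_le_pow_four_padic V hp5 hz
  have e : V.padicFormalLog z - z =
      (V.padicFormalLog z - (z + (2 : ℚ_[p])⁻¹ * V.a₁ * z ^ 2 + (3 : ℚ_[p])⁻¹ * (V.a₁ ^ 2 + V.a₂) * z ^ 3)) +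
        ((2 : ℚ_[p])⁻¹ * V.a₁ * z ^ 2 + (3 : ℚ_[p])⁻¹ * (V.a₁ ^ 2 + V.a₂) * z ^ 3) := by ring
  rw [e]
  have ha12 : ‖V.a₁ ^ 2 + V.a₂‖ ≤ 1 :=
    (norm_add_le_max _ _).trans (max_le (by rw [norm_pow]; exact pow_le_one₀ (norm_nonneg _) ha1) ha2)
  refine (norm_add_le_max _ _).trans (max_le (hτ.trans ?_) ((norm_add_le_max _ _).trans (max_le ?_ ?_)))
  · calc ‖z‖ ^ 4 = ‖z‖ ^ 2 * ‖z‖ ^ 2 := by ring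
      _ ≤ ‖z‖ ^ 2 * 1 := by gcongr; exact pow_le_one₀ hz0 hz1
      _ = ‖z‖ ^ 2 := mul_one _
  · rw [norm_mul, norm_mul, h2i, one_mul, norm_pow]
    calc ‖V.a₁‖ * ‖z‖ ^ 2 ≤ 1 * ‖z‖ ^ 2 := by gcongr
      _ = ‖z‖ ^ 2 := one_mul _
  · rw [norm_mul, norm_mul, h3i, one_mul, norm_pow]
    calc ‖V.a₁ ^ 2 + V.a₂‖ * ‖z‖ ^ 3 ≤ 1 * ‖z‖ ^ 3 := by gcongr
      _ = ‖z‖ * ‖z‖ ^ 2 := by ring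
      _ ≤ 1 * ‖z‖ ^ 2 := by gcongr
      _ = ‖z‖ ^ 2 := one_mul _

set_option maxHeartbeats 400000 in
/-- **`x = ℘(ℓ) − b₂/12` to fourth order at level one, `p ≥ 5`: `‖x·ℓ² − 1 + (b₂/12)·ℓ² − (c₄/240)·ℓ⁴‖_p ≤ ‖x‖_p⁻²`**
for a `p`-integral equation over `ℚ_p` (`p ≥ 5`) and a point `(x, y)` with `‖x‖_p > 1` and `‖z‖_p ≤ p⁻¹`
(`z = −x/y`, `ℓ = log_W z`; the level-one hypothesis is automatic for rational points of a minimal model). Mechanism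
in the module doc-string; the `p = 3` original (`norm_x_mul_formalLog_sq_sub_le`) needs level two.
[cite: SilvermanAEC2009, IV.1, IV.6.4, VI.3] -/
theorem norm_x_mul_formalLog_sq_sub_le_padic (hp5 : 5 ≤ p) {x y : ℚ_[p]} (heq : V.toAffine.Equation x y)
    (hx : 1 < ‖x‖) (hz : ‖-x / y‖ ≤ (p : ℝ)⁻¹) :
    ‖x * V.padicFormalLog (-x / y) ^ 2 - 1 + V.b₂ / 12 * V.padicFormalLog (-x / y) ^ 2 -
        V.c₄ / 240 * V.padicFormalLog (-x / y) ^ 4‖ ≤ ‖x‖⁻¹ ^ 2 := by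
  set z : ℚ_[p] := -x / y with hzdef
  set ℓ : ℚ_[p] := V.padicFormalLog z with hℓdef
  have hp2 : p ≠ 2 := by omega
  have hp3 : p ≠ 3 := by omega
  have hp1 : (1 : ℝ) ≤ p := by exact_mod_cast hp.out.one_lt.le
  have hp0 : (0 : ℝ) < p := by positivity
  obtain ⟨hsq, hxyn⟩ := V.norm_sq_eq_norm_cube heq hx
  have hx0 : 0 < ‖x‖ := one_pos.trans hx
  have hy0 : 0 < ‖y‖ := hx0.trans hxyn
  have hy0' : y ≠ 0 := norm_pos_iff.mp hy0
  have hz2 : ‖z‖ ^ 2 = ‖x‖⁻¹ := by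
    rw [hzdef, norm_div, norm_neg, div_pow, hsq]; field_simp
  have hr4 : ‖x‖⁻¹ ^ 2 = ‖z‖ ^ 4 := by rw [← hz2]; ring
  have hXz : ‖x‖ * ‖z‖ ^ 2 = 1 := by rw [hz2, mul_inv_cancel₀ hx0.ne']
  have hz0 : 0 ≤ ‖z‖ := norm_nonneg z
  have hz1 : ‖z‖ ≤ 1 := hz.trans (inv_le_one_of_one_le₀ hp1)
  have hpz : (p : ℝ) * ‖z‖ ≤ 1 := by
    calc (p : ℝ) * ‖z‖ ≤ p * (p : ℝ)⁻¹ := by gcongr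
      _ = 1 := mul_inv_cancel₀ hp0.ne'
  have hzpow : ∀ n : ℕ, ‖z‖ ^ (n + 1) ≤ ‖z‖ := fun n => by
    calc ‖z‖ ^ (n + 1) = ‖z‖ ^ n * ‖z‖ := pow_succ _ _
      _ ≤ 1 * ‖z‖ := by gcongr; exact pow_le_one₀ hz0 hz1
      _ = ‖z‖ := one_mul _
  obtain ⟨h₁, h₂, h₃, h₄, -⟩ := V.norm_coeffs_le_one
  -- units `2, 3, 4, 12` and the non-units `5, 240` (`‖·⁻¹‖ ≤ p`)
  have hunit : ∀ m : ℕ, Nat.Coprime p m → ‖((m : ℚ_[p]))⁻¹‖ = 1 := fun m hm => by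
    rw [norm_inv, Padic.norm_natCast_eq_one_iff.mpr hm, inv_one]
  have hcop2 : Nat.Coprime p 2 := (Nat.coprime_primes hp.out Nat.prime_two).mpr hp2
  have hcop3 : Nat.Coprime p 3 := (Nat.coprime_primes hp.out Nat.prime_three).mpr hp3
  have h2n : ‖(2 : ℚ_[p])‖ = 1 := by simpa using Padic.norm_natCast_eq_one_iff.mpr hcop2
  have h2i : ‖(2 : ℚ_[p])⁻¹‖ = 1 := by simpa using hunit 2 hcop2
  have h3i : ‖(3 : ℚ_[p])⁻¹‖ = 1 := by simpa using hunit 3 hcop3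
  have h4i : ‖(4 : ℚ_[p])⁻¹‖ = 1 := by
    have h4 : Nat.Coprime p 4 := by rw [show (4 : ℕ) = 2 ^ 2 by norm_num]; exact Nat.Coprime.pow_right 2 hcop2
    simpa using hunit 4 h4
  have h12i : ‖(12 : ℚ_[p])⁻¹‖ = 1 := by
    have h12 : Nat.Coprime p 12 := by
      rw [show (12 : ℕ) = 2 ^ 2 * 3 by norm_num]
      exact (Nat.Coprime.pow_right 2 hcop2).mul_right hcop3
    simpa using hunit 12 h12
  have h5i : ‖(5 : ℚ_[p])⁻¹‖ ≤ p := by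
    have h := norm_inv_smooth_le_padic hp5 0 0 1; norm_num at h; rw [norm_inv]; exact h
  have h240i : ‖(240 : ℚ_[p])⁻¹‖ ≤ p := by
    have h := norm_inv_smooth_le_padic hp5 4 1 1; norm_num at h; rw [norm_inv]; exact h
  have hc4 : ‖V.c₄‖ ≤ 1 := by
    have e := congrArg WeierstrassCurve.c₄ V.eq_map_integralModel
    rw [map_c₄] at e
    rw [← e]; exact PadicInt.norm_le_one _
  have hb2 : ‖V.b₂‖ ≤ 1 := by
    have e := congrArg WeierstrassCurve.b₂ V.eq_map_integralModel
    rw [map_b₂] at e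
    rw [← e]; exact PadicInt.norm_le_one _
  have hc240 : ‖V.c₄ / 240‖ ≤ p := by
    rw [div_eq_mul_inv, norm_mul]
    calc ‖V.c₄‖ * ‖(240 : ℚ_[p])⁻¹‖ ≤ 1 * p := by gcongr
      _ = p := one_mul _
  have hb12 : ‖V.b₂ / 12‖ ≤ 1 := by
    rw [div_eq_mul_inv, norm_mul, h12i, mul_one]; exact hb2
  -- `S` (the quintic truncation of `log_W/z`), `Q`, `τ`, `ρ`
  set S : ℚ_[p] := 1 + (2 : ℚ_[p])⁻¹ * V.a₁ * z + (3 : ℚ_[p])⁻¹ * (V.a₁ ^ 2 + V.a₂) * z ^ 2 +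
    (4 : ℚ_[p])⁻¹ * (V.a₁ ^ 3 + 2 * V.a₁ * V.a₂ + 2 * V.a₃) * z ^ 3 +
    (5 : ℚ_[p])⁻¹ * (V.a₁ ^ 4 + 3 * V.a₁ ^ 2 * V.a₂ + V.a₂ ^ 2 + 6 * V.a₁ * V.a₃ + 2 * V.a₄) * z ^ 4 with hSdef
  set Q : ℚ_[p] := 1 - V.a₁ * z - V.a₂ * z ^ 2 - V.a₃ * z ^ 3 with hQdef
  set τ : ℚ_[p] := ℓ - z * S with hτdef
  have hτ : ‖τ‖ ≤ ‖z‖ ^ 6 := by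
    have h := norm_padicFormalLog_sub_quintic_le_padic V hp5 hz
    have e : V.padicFormalLog z - (z + (2 : ℚ_[p])⁻¹ * V.a₁ * z ^ 2 + (3 : ℚ_[p])⁻¹ * (V.a₁ ^ 2 + V.a₂) * z ^ 3 +
        (4 : ℚ_[p])⁻¹ * (V.a₁ ^ 3 + 2 * V.a₁ * V.a₂ + 2 * V.a₃) * z ^ 4 +
        (5 : ℚ_[p])⁻¹ * (V.a₁ ^ 4 + 3 * V.a₁ ^ 2 * V.a₂ + V.a₂ ^ 2 + 6 * V.a₁ * V.a₃ + 2 * V.a₄) * z ^ 5) = τ := by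
      rw [hτdef, hSdef, hℓdef]; ring
    rwa [e] at h
  set ρ : ℚ_[p] := x * z ^ 2 - Q with hρdef
  have hρ : ‖ρ‖ ≤ ‖z‖ ^ 4 := by
    have h := norm_pow_three_div_sq_sub_quartic_le_padic heq hx
    have e : x ^ 3 / y ^ 2 - 1 - V.a₁ * (x / y) + V.a₂ * (x / y) ^ 2 - V.a₃ * (x / y) ^ 3 = ρ := by
      rw [hρdef, hQdef, hzdef]; field_simp; ring
    rw [e, hr4] at h; exact h
  -- the polynomial core (part 2a) at `aᵢ ∈ ℤ_p`
  have hpoly : ‖Q * S ^ 2 - 1 + (V.a₁ ^ 2 + 4 * V.a₂) / 12 * z ^ 2 * S ^ 2 -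
      ((V.a₁ ^ 2 + 4 * V.a₂) ^ 2 - 24 * (2 * V.a₄ + V.a₁ * V.a₃)) / 240 * z ^ 4‖ ≤ ‖z‖ ^ 4 :=
    norm_weierstrassP_poly_le_padic hp5 ⟨V.a₁, h₁⟩ ⟨V.a₂, h₂⟩ ⟨V.a₃, h₃⟩ ⟨V.a₄, h₄⟩ hz hQdef hSdef
  -- sizes of `S`, `S − 1`, `ℓ − z`, `ℓ`
  have hS1 : ‖S - 1‖ ≤ ‖z‖ := by
    have e : S - 1 = (2 : ℚ_[p])⁻¹ * V.a₁ * z + (3 : ℚ_[p])⁻¹ * (V.a₁ ^ 2 + V.a₂) * z ^ 2 +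
        (4 : ℚ_[p])⁻¹ * (V.a₁ ^ 3 + 2 * V.a₁ * V.a₂ + 2 * V.a₃) * z ^ 3 +
        (5 : ℚ_[p])⁻¹ * (V.a₁ ^ 4 + 3 * V.a₁ ^ 2 * V.a₂ + V.a₂ ^ 2 + 6 * V.a₁ * V.a₃ + 2 * V.a₄) * z ^ 4 := by
      rw [hSdef]; ring
    rw [e]
    have hA2 : ‖V.a₁ ^ 2 + V.a₂‖ ≤ 1 :=
      (norm_add_le_max _ _).trans (max_le (by rw [norm_pow]; exact pow_le_one₀ (norm_nonneg _) h₁) h₂)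
    have hA3 : ‖V.a₁ ^ 3 + 2 * V.a₁ * V.a₂ + 2 * V.a₃‖ ≤ 1 := by
      have e3 : V.a₁ ^ 3 + 2 * V.a₁ * V.a₂ + 2 * V.a₃ =
          (((⟨V.a₁, h₁⟩ ^ 3 + 2 * ⟨V.a₁, h₁⟩ * ⟨V.a₂, h₂⟩ + 2 * ⟨V.a₃, h₃⟩ : ℤ_[p])) : ℚ_[p]) := by
        push_cast [MordellDescent.padicInt_coe_ofNat]; ring
      rw [e3]; exact PadicInt.norm_le_one _
    have hA4 : ‖V.a₁ ^ 4 + 3 * V.a₁ ^ 2 * V.a₂ + V.a₂ ^ 2 + 6 * V.a₁ * V.a₃ + 2 * V.a₄‖ ≤ 1 := by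
      have e4 : V.a₁ ^ 4 + 3 * V.a₁ ^ 2 * V.a₂ + V.a₂ ^ 2 + 6 * V.a₁ * V.a₃ + 2 * V.a₄ =
          (((⟨V.a₁, h₁⟩ ^ 4 + 3 * ⟨V.a₁, h₁⟩ ^ 2 * ⟨V.a₂, h₂⟩ + ⟨V.a₂, h₂⟩ ^ 2 + 6 * ⟨V.a₁, h₁⟩ * ⟨V.a₃, h₃⟩ +
            2 * ⟨V.a₄, h₄⟩ : ℤ_[p])) : ℚ_[p]) := by
        push_cast [MordellDescent.padicInt_coe_ofNat]; ring
      rw [e4]; exact PadicInt.norm_le_one _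
    refine (norm_add_le_max _ _).trans (max_le ((norm_add_le_max _ _).trans (max_le
      ((norm_add_le_max _ _).trans (max_le ?_ ?_)) ?_)) ?_)
    · rw [norm_mul, norm_mul, h2i, one_mul]
      calc ‖V.a₁‖ * ‖z‖ ≤ 1 * ‖z‖ := by gcongr
        _ = ‖z‖ := one_mul _
    · rw [norm_mul, norm_mul, h3i, one_mul, norm_pow]
      calc ‖V.a₁ ^ 2 + V.a₂‖ * ‖z‖ ^ 2 ≤ 1 * ‖z‖ ^ 2 := by gcongr
        _ ≤ ‖z‖ := by rw [one_mul]; exact hzpow 1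
    · rw [norm_mul, norm_mul, h4i, one_mul, norm_pow]
      calc ‖V.a₁ ^ 3 + 2 * V.a₁ * V.a₂ + 2 * V.a₃‖ * ‖z‖ ^ 3 ≤ 1 * ‖z‖ ^ 3 := by gcongr
        _ ≤ ‖z‖ := by rw [one_mul]; exact hzpow 2
    · rw [norm_mul, norm_mul, norm_pow]
      calc ‖(5 : ℚ_[p])⁻¹‖ * ‖V.a₁ ^ 4 + 3 * V.a₁ ^ 2 * V.a₂ + V.a₂ ^ 2 + 6 * V.a₁ * V.a₃ + 2 * V.a₄‖ * ‖z‖ ^ 4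
          ≤ p * 1 * ‖z‖ ^ 4 := by gcongr
        _ = ((p : ℝ) * ‖z‖) * ‖z‖ ^ 3 := by ring
        _ ≤ 1 * ‖z‖ ^ 3 := by gcongr
        _ ≤ ‖z‖ := by rw [one_mul]; exact hzpow 2
  have hSn : ‖S‖ ≤ 1 := by
    rw [show S = (S - 1) + 1 by ring]
    exact (norm_add_le_max _ _).trans (max_le (hS1.trans hz1) (by rw [norm_one]))
  have hℓz : ‖ℓ - z‖ ≤ ‖z‖ ^ 2 := norm_padicFormalLog_sub_self_le_sq_padic V hp5 hz
  have hℓn : ‖ℓ‖ ≤ ‖z‖ := by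
    rw [show ℓ = (ℓ - z) + z by ring]
    exact (norm_add_le_max _ _).trans (max_le (hℓz.trans (hzpow 1)) le_rfl)
  -- the exact decomposition
  have hℓ : ℓ = z * S + τ := by rw [hτdef]; ring
  have hxz : x * z ^ 2 = Q + ρ := by rw [hρdef]; ring
  have hb2def : V.b₂ = V.a₁ ^ 2 + 4 * V.a₂ := rfl
  have hc4def : V.c₄ = (V.a₁ ^ 2 + 4 * V.a₂) ^ 2 - 24 * (2 * V.a₄ + V.a₁ * V.a₃) := rfl
  have hmain : x * ℓ ^ 2 - 1 + V.b₂ / 12 * ℓ ^ 2 - V.c₄ / 240 * ℓ ^ 4 =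
      (Q * S ^ 2 - 1 + (V.a₁ ^ 2 + 4 * V.a₂) / 12 * z ^ 2 * S ^ 2 -
        ((V.a₁ ^ 2 + 4 * V.a₂) ^ 2 - 24 * (2 * V.a₄ + V.a₁ * V.a₃)) / 240 * z ^ 4) +
      ρ * S ^ 2 + (x + V.b₂ / 12) * (2 * z * S * τ + τ ^ 2) - V.c₄ / 240 * (ℓ ^ 4 - z ^ 4) := by
    rw [hℓ, hb2def, hc4def]
    linear_combination (S ^ 2) * hxz
  rw [hmain, hr4]
  refine (norm_sub_le_max₃ _ _).trans (max_le ((norm_add_le_max _ _).trans (max_le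
    ((norm_add_le_max _ _).trans (max_le hpoly ?_)) ?_)) ?_)
  · -- `ρ S²`
    rw [norm_mul, norm_pow]
    calc ‖ρ‖ * ‖S‖ ^ 2 ≤ ‖z‖ ^ 4 * 1 ^ 2 := by gcongr
      _ = ‖z‖ ^ 4 := by ring
  · -- `(x + b₂/12)(2zSτ + τ²)`: `‖·‖ ≤ ‖x‖·‖z‖⁷ = ‖z‖⁵`
    have hxb : ‖x + V.b₂ / 12‖ ≤ ‖x‖ := (norm_add_le_max _ _).trans (max_le le_rfl (hb12.trans hx.le))
    have hin : ‖2 * z * S * τ + τ ^ 2‖ ≤ ‖z‖ ^ 7 := by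
      refine (norm_add_le_max _ _).trans (max_le ?_ ?_)
      · rw [norm_mul, norm_mul, norm_mul, h2n, one_mul]
        calc ‖z‖ * ‖S‖ * ‖τ‖ ≤ ‖z‖ * 1 * ‖z‖ ^ 6 := by gcongr
          _ = ‖z‖ ^ 7 := by ring
      · rw [norm_pow]
        calc ‖τ‖ ^ 2 ≤ (‖z‖ ^ 6) ^ 2 := by gcongr
          _ = ‖z‖ ^ 5 * ‖z‖ ^ 7 := by ring
          _ ≤ 1 * ‖z‖ ^ 7 := by gcongr; exact pow_le_one₀ hz0 hz1
          _ = ‖z‖ ^ 7 := one_mul _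
    rw [norm_mul]
    calc ‖x + V.b₂ / 12‖ * ‖2 * z * S * τ + τ ^ 2‖ ≤ ‖x‖ * ‖z‖ ^ 7 := by gcongr
      _ = (‖x‖ * ‖z‖ ^ 2) * ‖z‖ * ‖z‖ ^ 4 := by ring
      _ = ‖z‖ * ‖z‖ ^ 4 := by rw [hXz, one_mul]
      _ ≤ 1 * ‖z‖ ^ 4 := by gcongr
      _ = ‖z‖ ^ 4 := one_mul _
  · -- `(c₄/240)(ℓ⁴ − z⁴)`: `‖ℓ⁴ − z⁴‖ ≤ ‖z‖⁵`, `‖c₄/240‖ ≤ p`, `p‖z‖ ≤ 1`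
    have hfac : ℓ ^ 4 - z ^ 4 = (ℓ - z) * ((ℓ + z) * (ℓ ^ 2 + z ^ 2)) := by ring
    have hplus : ‖ℓ + z‖ ≤ ‖z‖ := (norm_add_le_max _ _).trans (max_le hℓn le_rfl)
    have hsq2 : ‖ℓ ^ 2 + z ^ 2‖ ≤ ‖z‖ ^ 2 := by
      refine (norm_add_le_max _ _).trans (max_le ?_ (by rw [norm_pow]))
      rw [norm_pow]; exact pow_le_pow_left₀ (norm_nonneg _) hℓn 2
    rw [norm_mul, hfac, norm_mul, norm_mul]
    calc ‖V.c₄ / 240‖ * (‖ℓ - z‖ * (‖ℓ + z‖ * ‖ℓ ^ 2 + z ^ 2‖))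
        ≤ p * (‖z‖ ^ 2 * (‖z‖ * ‖z‖ ^ 2)) := by gcongr
      _ = ((p : ℝ) * ‖z‖) * ‖z‖ ^ 4 := by ring
      _ ≤ 1 * ‖z‖ ^ 4 := by gcongr
      _ = ‖z‖ ^ 4 := one_mul _

set_option maxHeartbeats 400000 in
/-- **`log_p(x·ℓ²) = −(b₂/12)ℓ² + (c₄/240 − b₂²/288)ℓ⁴ + O(‖x‖_p⁻²)` at level one, `p ≥ 5`**, for a `p`-integral
equation over `ℚ_p` and a point `(x, y)` with `‖x‖_p > 1`, `‖z‖_p ≤ p⁻¹` (`z = −x/y`, `ℓ = log_W z`): with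
`u = x·ℓ² − 1 = −(b₂/12)ℓ² + (c₄/240)ℓ⁴ + O(‖x‖⁻²)` (`‖u‖ ≤ ‖z‖²`, `‖u + (b₂/12)ℓ²‖ ≤ p‖z‖⁴`),
`log_p(1+u) = u − u²/2 + O(‖u‖³)` (part 1b) and `u² = (b₂²/144)ℓ⁴ + O(p‖z‖⁶)`; `p‖z‖² ≤ 1`. The `p = 3` original
is `norm_padicLog_x_mul_formalLog_sq_sub_le` (level two). [cite: SilvermanAEC2009, IV.1, IV.6.4]
[cite: Iwasawa1972PadicL, §4.4] -/
theorem norm_padicLog_x_mul_formalLog_sq_sub_le_padic (hp5 : 5 ≤ p) {x y : ℚ_[p]} (heq : V.toAffine.Equation x y)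
    (hx : 1 < ‖x‖) (hz : ‖-x / y‖ ≤ (p : ℝ)⁻¹) :
    ‖padicLog p (x * V.padicFormalLog (-x / y) ^ 2) -
        (-(V.b₂ / 12) * V.padicFormalLog (-x / y) ^ 2 +
          (V.c₄ / 240 - V.b₂ ^ 2 / 288) * V.padicFormalLog (-x / y) ^ 4)‖ ≤ ‖x‖⁻¹ ^ 2 := by
  set z : ℚ_[p] := -x / y with hzdef
  set ℓ : ℚ_[p] := V.padicFormalLog z with hℓdef
  have hp2 : p ≠ 2 := by omega
  have hp3 : p ≠ 3 := by omega
  have hp1 : (1 : ℝ) ≤ p := by exact_mod_cast hp.out.one_lt.le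
  have hp0 : (0 : ℝ) < p := by positivity
  obtain ⟨hsq, hxyn⟩ := V.norm_sq_eq_norm_cube heq hx
  have hx0 : 0 < ‖x‖ := one_pos.trans hx
  have hz2 : ‖z‖ ^ 2 = ‖x‖⁻¹ := by
    rw [hzdef, norm_div, norm_neg, div_pow, hsq]; field_simp
  have hr4 : ‖x‖⁻¹ ^ 2 = ‖z‖ ^ 4 := by rw [← hz2]; ring
  have hz0 : 0 ≤ ‖z‖ := norm_nonneg z
  have hz1 : ‖z‖ ≤ 1 := hz.trans (inv_le_one_of_one_le₀ hp1)
  have hpz : (p : ℝ) * ‖z‖ ≤ 1 := by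
    calc (p : ℝ) * ‖z‖ ≤ p * (p : ℝ)⁻¹ := by gcongr
      _ = 1 := mul_inv_cancel₀ hp0.ne'
  have hpz2 : (p : ℝ) * ‖z‖ ^ 2 ≤ 1 := by
    calc (p : ℝ) * ‖z‖ ^ 2 = ((p : ℝ) * ‖z‖) * ‖z‖ := by ring
      _ ≤ 1 * 1 := mul_le_mul hpz hz1 hz0 zero_le_one
      _ = 1 := one_mul _
  have hzp : ‖z‖ ^ 2 ≤ (p : ℝ)⁻¹ := by
    calc ‖z‖ ^ 2 = ‖z‖ * ‖z‖ := sq _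
      _ ≤ 1 * (p : ℝ)⁻¹ := mul_le_mul hz1 hz hz0 zero_le_one
      _ = (p : ℝ)⁻¹ := one_mul _
  -- the input of the `℘`-lemma and the size of `ℓ`
  have hA : ‖x * ℓ ^ 2 - 1 + V.b₂ / 12 * ℓ ^ 2 - V.c₄ / 240 * ℓ ^ 4‖ ≤ ‖z‖ ^ 4 := by
    have h := norm_x_mul_formalLog_sq_sub_le_padic V hp5 heq hx hz
    rw [hr4] at h; exact h
  have hℓn : ‖ℓ‖ ≤ ‖z‖ := by
    have hℓz : ‖ℓ - z‖ ≤ ‖z‖ ^ 2 := norm_padicFormalLog_sub_self_le_sq_padic V hp5 hz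
    rw [show ℓ = (ℓ - z) + z by ring]
    refine (norm_add_le_max _ _).trans (max_le (hℓz.trans ?_) le_rfl)
    calc ‖z‖ ^ 2 = ‖z‖ * ‖z‖ := sq _
      _ ≤ 1 * ‖z‖ := by gcongr
      _ = ‖z‖ := one_mul _
  -- constants
  have hunit : ∀ m : ℕ, Nat.Coprime p m → ‖((m : ℚ_[p]))⁻¹‖ = 1 := fun m hm => by
    rw [norm_inv, Padic.norm_natCast_eq_one_iff.mpr hm, inv_one]
  have hcop2 : Nat.Coprime p 2 := (Nat.coprime_primes hp.out Nat.prime_two).mpr hp2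
  have hcop3 : Nat.Coprime p 3 := (Nat.coprime_primes hp.out Nat.prime_three).mpr hp3
  have h2n : ‖(2 : ℚ_[p])‖ = 1 := by simpa using Padic.norm_natCast_eq_one_iff.mpr hcop2
  have h12i : ‖(12 : ℚ_[p])⁻¹‖ = 1 := by
    have h12 : Nat.Coprime p 12 := by
      rw [show (12 : ℕ) = 2 ^ 2 * 3 by norm_num]
      exact (Nat.Coprime.pow_right 2 hcop2).mul_right hcop3
    simpa using hunit 12 h12
  have h240i : ‖(240 : ℚ_[p])⁻¹‖ ≤ p := by
    have h := norm_inv_smooth_le_padic hp5 4 1 1; norm_num at h; rw [norm_inv]; exact h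
  have hb2 : ‖V.b₂‖ ≤ 1 := by
    have e := congrArg WeierstrassCurve.b₂ V.eq_map_integralModel
    rw [map_b₂] at e
    rw [← e]; exact PadicInt.norm_le_one _
  have hc4 : ‖V.c₄‖ ≤ 1 := by
    have e := congrArg WeierstrassCurve.c₄ V.eq_map_integralModel
    rw [map_c₄] at e
    rw [← e]; exact PadicInt.norm_le_one _
  have hb12 : ‖V.b₂ / 12‖ ≤ 1 := by rw [div_eq_mul_inv, norm_mul, h12i, mul_one]; exact hb2
  have hc240 : ‖V.c₄ / 240‖ ≤ p := by
    rw [div_eq_mul_inv, norm_mul]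
    calc ‖V.c₄‖ * ‖(240 : ℚ_[p])⁻¹‖ ≤ 1 * p := by gcongr
      _ = p := one_mul _
  clear_value z ℓ
  -- `u = x ℓ² − 1 = A + E`, `A = −(b₂/12)ℓ²`, `‖E‖ ≤ p‖z‖⁴`, `‖u‖ ≤ ‖z‖²`
  set u : ℚ_[p] := x * ℓ ^ 2 - 1 with hudef
  set A : ℚ_[p] := -(V.b₂ / 12) * ℓ ^ 2 with hAdef
  set g : ℚ_[p] := x * ℓ ^ 2 - 1 + V.b₂ / 12 * ℓ ^ 2 - V.c₄ / 240 * ℓ ^ 4 with hgdef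
  have hg : ‖g‖ ≤ ‖z‖ ^ 4 := hA
  have hE_eq : u - A = V.c₄ / 240 * ℓ ^ 4 + g := by rw [hudef, hAdef, hgdef]; ring
  have hℓ4 : ‖ℓ ^ 4‖ ≤ ‖z‖ ^ 4 := by rw [norm_pow]; exact pow_le_pow_left₀ (norm_nonneg _) hℓn 4
  have hE : ‖u - A‖ ≤ p * ‖z‖ ^ 4 := by
    rw [hE_eq]
    have hz4 : ‖z‖ ^ 4 ≤ p * ‖z‖ ^ 4 := le_mul_of_one_le_left (pow_nonneg hz0 4) hp1
    refine (norm_add_le_max _ _).trans (max_le ?_ (hg.trans hz4))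
    rw [norm_mul]
    exact mul_le_mul hc240 hℓ4 (norm_nonneg _) hp0.le
  have hAn : ‖A‖ ≤ ‖z‖ ^ 2 := by
    rw [hAdef, norm_mul, norm_neg, norm_pow]
    calc ‖V.b₂ / 12‖ * ‖ℓ‖ ^ 2 ≤ 1 * ‖z‖ ^ 2 := by gcongr
      _ = ‖z‖ ^ 2 := one_mul _
  have hpz4 : (p : ℝ) * ‖z‖ ^ 4 ≤ ‖z‖ ^ 2 := by
    calc (p : ℝ) * ‖z‖ ^ 4 = ((p : ℝ) * ‖z‖ ^ 2) * ‖z‖ ^ 2 := by ring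
      _ ≤ 1 * ‖z‖ ^ 2 := by gcongr
      _ = ‖z‖ ^ 2 := one_mul _
  have hun : ‖u‖ ≤ ‖z‖ ^ 2 := by
    rw [show u = (u - A) + A by ring]
    exact (norm_add_le_max _ _).trans (max_le (hE.trans hpz4) hAn)
  have hup : ‖u‖ ≤ (p : ℝ)⁻¹ := hun.trans hzp
  -- `log(1 + u) = u − u²/2 + O(‖u‖³)`
  have hlog := norm_padicLog_one_add_sub_sub_le_padic hp5 hup
  have h1u : 1 + u = x * ℓ ^ 2 := by rw [hudef]; ring
  rw [h1u] at hlog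
  -- `u² = A² + (u − A)(u + A)`, `A² = (b₂²/144) ℓ⁴`
  have hfin : padicLog p (x * ℓ ^ 2) - (-(V.b₂ / 12) * ℓ ^ 2 + (V.c₄ / 240 - V.b₂ ^ 2 / 288) * ℓ ^ 4) =
      (padicLog p (x * ℓ ^ 2) - (u - u ^ 2 / 2)) + g - (2 : ℚ_[p])⁻¹ * ((u - A) * (u + A)) := by
    rw [hgdef, hudef, hAdef]; ring
  rw [hfin, hr4]
  refine (norm_sub_le_max₃ _ _).trans (max_le ((norm_add_le_max _ _).trans (max_le (hlog.trans ?_) hg)) ?_)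
  · calc ‖u‖ ^ 3 ≤ (‖z‖ ^ 2) ^ 3 := by gcongr
      _ = ‖z‖ ^ 2 * ‖z‖ ^ 4 := by ring
      _ ≤ 1 * ‖z‖ ^ 4 := by gcongr; exact pow_le_one₀ hz0 hz1
      _ = ‖z‖ ^ 4 := one_mul _
  · rw [norm_mul, norm_inv, h2n, inv_one, one_mul, norm_mul]
    have huA : ‖u + A‖ ≤ ‖z‖ ^ 2 := (norm_add_le_max _ _).trans (max_le hun hAn)
    calc ‖u - A‖ * ‖u + A‖ ≤ (p * ‖z‖ ^ 4) * ‖z‖ ^ 2 := by gcongr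
      _ = ((p : ℝ) * ‖z‖ ^ 2) * ‖z‖ ^ 4 := by ring
      _ ≤ 1 * ‖z‖ ^ 4 := by gcongr
      _ = ‖z‖ ^ 4 := one_mul _

end WeierstrassP

end Summit.BirchSwinnertonDyer.Rank1Residual.X11b.RegMult.HeightLogNumerator

end
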